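import Literature.Geometry.Lorentzian.DiagonalMetricCoord
import Literature.Geometry.Lorentzian.ChartMetricCoord
import Literature.Geometry.Lorentzian.KerrSchild
import Literature.Geometry.Lorentzian.Einstein
import HarnessLib

/-!
# Lorentzian metrics on chart domains of `E4` with diagonal components

Support file (everything proved, no named facts) for the explicit vacuum spacetime of
`Literature.Geometry.Lorentzian.christodoulou_trapped_surface_formation_holds`. Given scalar
functions `g₀ < 0 < g₁, g₂, g₃`, smooth on an open set `V ⊆ E4`, the diagonal components
`G_y(v,w) = ∑ gᵢ(y) vᵢ wᵢ` (`MetricCoord.diagMetric g`, `DiagonalMetricCoord.lean`) define a `C^∞`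
Lorentzian metric `OpensChart.diagLorentz` on the chart domain `V : Opens E4` (O'Neill 1983,
Ch. 3, Def. 3.1 and p. 55: a metric tensor of index one in orthogonal coordinates), time-oriented
by `± ∂₀` (`OpensChart.diagTimeOrientation`). The abstract curvature of this metric is read off
the coordinate calculus (`ChartMetricCoord.lean`): `ricci_diagLorentz_eb`,
`isRicciFlat_diagLorentz_of_ricAt_eb` (Ricci-flatness from the vanishing of `Ric(e_b, e_c)`),
`riemann_diagLorentz_eq_zero_of_eb` (flatness at a point from the vanishing of the paired
components `G(R(eₐ,e_b)e_c, e_e)`).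

## References

* B. O'Neill, *Semi-Riemannian geometry with applications to relativity*, Academic Press 1983,
  Ch. 3, Def. 3.1, p. 55, Lemma 3.38, Lemma 3.52; Ch. 5, Lemma 5.26. [ONeill1983]
-/

noncomputable section

set_option maxSynthPendingDepth 3

open Set Filter TopologicalSpace Bundle
open scoped Topology ContDiff Manifold

namespace Literature.Geometry.Lorentzian

namespace OpensChart

open MetricCoord

/-! ### The scaling to Minkowski form -/

/-- Linear algebra of a diagonal Lorentzian form: with `c₀ < 0 < c₁, c₂, c₃` and the scaling
`S v = (√(-c₀) v₀, √c₁ v₁, √c₂ v₂, √c₃ v₃)`, `diagForm c v w = η(S v, S w)`. [cite: ONeill1983, Ch. 3, p. 55] -/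
theorem diagForm_eq_minkowski (c : Fin 4 → ℝ) (h0 : c 0 < 0) (hpos : ∀ i : Fin 3, 0 < c i.succ)
    (v w : E4) :
    diagForm c v w =
      Minkowski.bilin
        (WithLp.toLp 2 fun μ ↦ Fin.cases (√(-c 0) * v 0) (fun i ↦ √(c i.succ) * v i.succ) μ)
        (WithLp.toLp 2 fun μ ↦ Fin.cases (√(-c 0) * w 0) (fun i ↦ √(c i.succ) * w i.succ) μ) := by
  rw [diagForm_apply, Minkowski.bilin_apply, Fin.sum_univ_four, Fin.sum_univ_three]
  simp only [Fin.cases_zero, Fin.cases_succ,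
    show (1 : Fin 4) = (0 : Fin 3).succ from rfl, show (2 : Fin 4) = (1 : Fin 3).succ from rfl,
    show (3 : Fin 4) = (2 : Fin 3).succ from rfl]
  have hs0 : √(-c 0) * √(-c 0) = -c 0 := Real.mul_self_sqrt (by linarith)
  have hs : ∀ i : Fin 3, √(c i.succ) * √(c i.succ) = c i.succ := fun i ↦
    Real.mul_self_sqrt (hpos i).le
  have e0 : -(√(-c 0) * v 0 * (√(-c 0) * w 0)) = c 0 * (v 0 * w 0) := by
    rw [show √(-c 0) * v 0 * (√(-c 0) * w 0) = (√(-c 0) * √(-c 0)) * (v 0 * w 0) by ring, hs0]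
    ring
  have e : ∀ i : Fin 3, √(c i.succ) * v i.succ * (√(c i.succ) * w i.succ) =
      c i.succ * (v i.succ * w i.succ) := fun i ↦ by
    rw [show √(c i.succ) * v i.succ * (√(c i.succ) * w i.succ) =
      (√(c i.succ) * √(c i.succ)) * (v i.succ * w i.succ) by ring, hs i]
  rw [e0, e 0, e 1, e 2]
  ring

/-- **The orthogonal complement of a timelike vector is spacelike** for a diagonal form of
Lorentzian signature (O'Neill 1983, Ch. 5, Lemma 5.26, transported from `η` by the scaling
`S`). [cite: ONeill1983, Ch. 5, Lemma 5.26] -/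
theorem diagForm_pos_of_orthogonal (c : Fin 4 → ℝ) (h0 : c 0 < 0)
    (hpos : ∀ i : Fin 3, 0 < c i.succ) (v w : E4) (hv : diagForm c v v < 0)
    (hvw : diagForm c v w = 0) (hw : w ≠ 0) : 0 < diagForm c w w := by
  rw [diagForm_eq_minkowski c h0 hpos] at hv hvw ⊢
  refine Minkowski.bilin_pos_of_orthogonal _ _ hv hvw ?_
  intro h
  apply hw
  ext μ
  refine Fin.cases ?_ (fun i ↦ ?_) μ
  · have h0' : √(-c 0) * w 0 = 0 := by simpa using congrArg (fun z : E4 ↦ z 0) h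
    have hne : √(-c 0) ≠ 0 := (Real.sqrt_pos.mpr (by linarith)).ne'
    simpa [hne] using h0'
  · have hi : √(c i.succ) * w i.succ = 0 := by simpa using congrArg (fun z : E4 ↦ z i.succ) h
    have hne : √(c i.succ) ≠ 0 := (Real.sqrt_pos.mpr (hpos i)).ne'
    simpa [hne] using hi

/-! ### The metric -/

variable {V : Opens E4} {g : Fin 4 → E4 → ℝ}

/-- **The Lorentzian metric of diagonal components on a chart domain.** For scalar functions
`gᵢ`, smooth on the open set `V ⊆ E4`, with `g₀ < 0` and `g₁, g₂, g₃ > 0` on `V`, the components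
`G_y = ∑ gᵢ(y) dyⁱ ⊗ dyⁱ` define a `C^∞` Lorentzian metric on `V : Opens E4` (a metric of index
one in orthogonal coordinates; O'Neill 1983, Ch. 3, Def. 3.1 and p. 55). [cite: ONeill1983, Ch. 3, Def. 3.1] -/
def diagLorentz (V : Opens E4) (g : Fin 4 → E4 → ℝ) (hg : ∀ i, ContDiffOn ℝ ∞ (g i) V)
    (h0 : ∀ y ∈ (V : Set E4), g 0 y < 0) (hpos : ∀ i : Fin 3, ∀ y ∈ (V : Set E4), 0 < g i.succ y) :
    LorentzianMetric 𝓘(ℝ, E4) ∞ V where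
  val y := diagMetric g y.1
  symm y v w := diagForm_symm _ v w
  nondegenerate y v hv := by
    have hc : ∀ i, g i y.1 ≠ 0 := by
      intro i
      refine Fin.cases ?_ (fun j ↦ ?_) i
      · exact (h0 y.1 y.2).ne
      · exact (hpos j y.1 y.2).ne'
    have hinv := isInvertible_diagForm (c := fun i ↦ g i y.1) hc
    have hz : diagForm (fun i ↦ g i y.1) (show E4 from v) = diagForm (fun i ↦ g i y.1) 0 := by
      rw [map_zero]
      ext w
      exact hv w
    exact hinv.injective hz
  contMDiff y :=
    (contMDiffAt_bilinSection_iff y _ (diagMetric g) (fun _ ↦ rfl)).2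
      ((contDiffOn_diagMetric hg).contDiffAt (V.2.mem_nhds y.2))
  exists_timelike y := ⟨eb 0, by
    change diagMetric g y.1 (eb 0) (eb 0) < 0
    rw [diagMetric_eb_eb, if_pos rfl]
    exact h0 y.1 y.2⟩
  pos_of_orthogonal y v w hv hvw hw :=
    diagForm_pos_of_orthogonal (fun i ↦ g i y.1) (h0 y.1 y.2) (fun i ↦ hpos i y.1 y.2) v w hv hvw hw

variable {hg : ∀ i, ContDiffOn ℝ ∞ (g i) V} {h0 : ∀ y ∈ (V : Set E4), g 0 y < 0}
  {hpos : ∀ i : Fin 3, ∀ y ∈ (V : Set E4), 0 < g i.succ y}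

/-- The value of the diagonal metric is the diagonal components (by definition). [folklore] -/
@[simp]
theorem diagLorentz_val (y : V) : (diagLorentz V g hg h0 hpos).val y = diagMetric g y.1 := rfl

/-- The representative hypothesis `g.val y = G y` of the `OpensChart` calculus, for the diagonal
metric. [folklore] -/
theorem diagLorentz_repr :
    ∀ y : V, (diagLorentz V g hg h0 hpos).toPseudoRiemannianMetric.val y = diagMetric g y.1 :=
  fun _ ↦ rfl

/-- The entries are nonzero on `V`. [folklore] -/
theorem diag_ne_zero (h0 : ∀ y ∈ (V : Set E4), g 0 y < 0)
    (hpos : ∀ i : Fin 3, ∀ y ∈ (V : Set E4), 0 < g i.succ y) (i : Fin 4) :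
    ∀ y ∈ (V : Set E4), g i y ≠ 0 := by
  intro y hy
  refine Fin.cases ?_ (fun j ↦ ?_) i
  · exact (h0 y hy).ne
  · exact (hpos j y hy).ne'

/-! ### Time orientation by `± ∂₀` -/

/-- **Time orientation of a diagonal chart metric by `s ∂₀`**, `s ≠ 0` (`s = 1`: increasing
`y⁰` is the future; `s = -1`: decreasing `y⁰` is the future): a constant, hence smooth, timelike
vector field (`G(∂₀, ∂₀) = g₀ < 0`). O'Neill 1983, Ch. 5, p. 145. [cite: ONeill1983, Ch. 5, p. 145] -/
def diagTimeOrientation (s : ℝ) (hs : s ≠ 0) : TimeOrientation (diagLorentz V g hg h0 hpos) where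
  vectorField _ := s • (eb 0 : E4)
  isTimelike y := by
    change diagMetric g y.1 (s • (eb 0 : E4)) (s • (eb 0 : E4)) < 0
    rw [map_smul, map_smul, FunLike.coe_smul, Pi.smul_apply, diagMetric_eb_eb, if_pos rfl,
      smul_eq_mul, smul_eq_mul]
    have : 0 < s * s := mul_self_pos.mpr hs
    nlinarith [h0 y.1 y.2]
  contMDiff x := contMDiffAt_const_section x _

/-- The orienting vector field is `s ∂₀`. [folklore] -/
@[simp]
theorem diagTimeOrientation_vectorField (s : ℝ) (hs : s ≠ 0) (y : V) :
    (diagTimeOrientation (hg := hg) (h0 := h0) (hpos := hpos) s hs).vectorField y =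
      s • (eb 0 : E4) := rfl

/-! ### Curvature read in the chart -/

/-- **The Ricci tensor of the diagonal chart metric on coordinate vectors is the coordinate
Ricci form** (`ChartMetricCoord.ricci_eq_ricAt`). [cite: ONeill1983, Ch. 3, Lemma 3.52] -/
theorem ricci_diagLorentz [(diagLorentz V g hg h0 hpos).toPseudoRiemannianMetric.HasLeviCivita]
    (y : V) (Y Z : E4) :
    (diagLorentz V g hg h0 hpos).toPseudoRiemannianMetric.ricci y Y Z = ricAt (diagMetric g) y Y Z :=
  ricci_eq_ricAt (diagLorentz_repr (hg := hg) (h0 := h0) (hpos := hpos)) y Y Z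

/-- **Ricci-flatness criterion**: if the coordinate Ricci form vanishes on all pairs of coordinate
vectors at every point of `V`, the diagonal chart metric is Ricci-flat (`Ric = 0` is bilinear).
[cite: ONeill1983, Ch. 3, after Lemma 3.52] -/
theorem isRicciFlat_diagLorentz_of_ricAt_eb
    [(diagLorentz V g hg h0 hpos).toPseudoRiemannianMetric.HasLeviCivita]
    (h : ∀ y : V, ∀ b c : Fin 4, ricAt (diagMetric g) y.1 (eb b) (eb c) = 0) :
    (diagLorentz V g hg h0 hpos).toPseudoRiemannianMetric.IsRicciFlat := by
  intro y
  ext Y Z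
  rw [ricci_diagLorentz y Y Z, LinearMap.zero_apply, LinearMap.zero_apply]
  suffices hYZ : ∀ Y Z : E4, ricAt (diagMetric g) y.1 Y Z = 0 from hYZ Y Z
  intro Y Z
  -- expand `Y` and `Z` in the coordinate basis
  have hY : Y = ∑ b, Y b • (eb b : E4) := by
    simpa using ((EuclideanSpace.basisFun (Fin 4) ℝ).sum_repr Y).symm
  have hZ : Z = ∑ c, Z c • (eb c : E4) := by
    simpa using ((EuclideanSpace.basisFun (Fin 4) ℝ).sum_repr Z).symm
  rw [hY, map_sum, FunLike.coe_sum, Finset.sum_apply]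
  refine Finset.sum_eq_zero fun b _ ↦ ?_
  rw [map_smul, FunLike.coe_smul, Pi.smul_apply, hZ, map_sum]
  rw [Finset.sum_eq_zero fun c _ ↦ ?_, smul_zero]
  rw [map_smul, h y b c, smul_zero]

/-- **The Riemann tensor of the diagonal chart metric is the coordinate curvature**
(`ChartMetricCoord.riemann_eq_riemAt`). [cite: ONeill1983, Ch. 3, Lemma 3.38] -/
theorem riemann_diagLorentz [(diagLorentz V g hg h0 hpos).toPseudoRiemannianMetric.HasLeviCivita]
    (y : V) (X Y Z : E4) :
    (diagLorentz V g hg h0 hpos).toPseudoRiemannianMetric.riemann y X Y Z =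
      riemAt (diagMetric g) y X Y Z :=
  riemann_eq_riemAt (diagLorentz_repr (hg := hg) (h0 := h0) (hpos := hpos)) y X Y Z

/-- **Flatness criterion at a point**: if all paired coordinate components
`G(R(eₐ, e_b) e_c, e_e)` of the coordinate curvature vanish at `y`, the Riemann tensor of the
diagonal chart metric vanishes at `y` (trilinearity, and nondegeneracy of the diagonal pairing:
`G(v, e_e) = g_e v_e`). [cite: ONeill1983, Ch. 3, Lemma 3.38] -/
theorem riemann_diagLorentz_eq_zero_of_eb
    [(diagLorentz V g hg h0 hpos).toPseudoRiemannianMetric.HasLeviCivita] (y : V)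
    (h : ∀ a b c e : Fin 4,
      diagMetric g y.1 (riemAt (diagMetric g) y.1 (eb a) (eb b) (eb c)) (eb e) = 0) :
    (diagLorentz V g hg h0 hpos).toPseudoRiemannianMetric.riemann y = 0 := by
  have hne : ∀ i, g i y.1 ≠ 0 := fun i ↦ diag_ne_zero h0 hpos i y.1 y.2
  -- each basis value of the curvature vanishes as a vector
  have hvec : ∀ a b c : Fin 4, riemAt (diagMetric g) y.1 (eb a) (eb b) (eb c) = 0 := by
    intro a b c
    ext e
    have := h a b c e
    rw [diagMetric_eb_right] at this
    simpa [hne e] using this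
  ext X Y Z
  rw [riemann_diagLorentz y X Y Z]
  suffices hXYZ : ∀ X Y Z : E4, riemAt (diagMetric g) y.1 X Y Z = 0 from hXYZ X Y Z
  intro X Y Z
  have hX : X = ∑ a, X a • (eb a : E4) := by
    simpa using ((EuclideanSpace.basisFun (Fin 4) ℝ).sum_repr X).symm
  have hY : Y = ∑ b, Y b • (eb b : E4) := by
    simpa using ((EuclideanSpace.basisFun (Fin 4) ℝ).sum_repr Y).symm
  have hZ : Z = ∑ c, Z c • (eb c : E4) := by
    simpa using ((EuclideanSpace.basisFun (Fin 4) ℝ).sum_repr Z).symm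
  have key : riemAt (diagMetric g) y.1 X Y Z = 0 := by
    rw [hX]
    -- linearity in the first slot
    have h1 : ∀ (s : Finset (Fin 4)), riemAt (diagMetric g) y.1 (∑ a ∈ s, X a • (eb a : E4)) Y Z =
        ∑ a ∈ s, X a • riemAt (diagMetric g) y.1 (eb a) Y Z := by
      intro s
      induction s using Finset.induction_on with
      | empty =>
        simp only [Finset.sum_empty]
        rw [show (0 : E4) = (0 : ℝ) • (eb 0 : E4) by simp, riemAt_smul_left]
        simp
      | insert a s ha ih =>
        rw [Finset.sum_insert ha, Finset.sum_insert ha, riemAt_add_left, _root_.add_apply,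
          riemAt_smul_left, FunLike.coe_smul, Pi.smul_apply, ih]
    rw [h1]
    refine Finset.sum_eq_zero fun a _ ↦ ?_
    rw [hY]
    have h2 : ∀ (s : Finset (Fin 4)), riemAt (diagMetric g) y.1 (eb a) (∑ b ∈ s, Y b • (eb b : E4)) Z =
        ∑ b ∈ s, Y b • riemAt (diagMetric g) y.1 (eb a) (eb b) Z := by
      intro s
      induction s using Finset.induction_on with
      | empty =>
        simp only [Finset.sum_empty]
        rw [show (0 : E4) = (0 : ℝ) • (eb 0 : E4) by simp, riemAt_smul_right]
        simp
      | insert b s hb ih =>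
        rw [Finset.sum_insert hb, Finset.sum_insert hb, riemAt_add_right, _root_.add_apply,
          riemAt_smul_right, FunLike.coe_smul, Pi.smul_apply, ih]
    rw [h2, Finset.sum_eq_zero fun b _ ↦ ?_, smul_zero]
    rw [hZ, map_sum, Finset.sum_eq_zero fun c _ ↦ ?_, smul_zero]
    rw [map_smul, hvec a b c, smul_zero]
  exact key

end OpensChart

end Literature.Geometry.Lorentzian
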